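import Summits.BirchSwinnertonDyer.BirchSwinnertonDyer.Theorems.PrintCf2RubinValueTwoRowTwoCokernel
import Mathlib.Algebra.Group.Action.End
import Mathlib.Data.Fintype.Perm
import HarnessLib

/-!
# M-LINE-PIN / (α3) ROW 2, FILE 8j: `hgcoker` with the places-fixing hypothesis `hfix` replaced by a UNIFORM BOUND on the number of places above `p`
# in the layers `F_n` (every `σ ∈ Gal(F_n/K)` raised to `B!` fixes them)

Cell `bsd-print-cf2`, WIDTH seat `bsd-line-cf2-p1-w6` g10 (prover-bsd-line-cf2-p1-w6-g10-0); `--supports` stmt-BirchSwinnertonDyer-24721 (helper, Theses-free).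
HONEST FRAMING: a permutation of a set with `≤ B` elements has order dividing `B!`; so FILE 8i's displayed `hfix₁/hfix₂` ("`ηᵢ^M` fixes the places of
every `F_n` above `p`") follow, with `M = B!`, from `hbound : ∀ n, #{places of F_n above p} ≤ B` — on the DA7 frame `B = 4` (one place above each of `v, v̄`
in `K̃_n` by g8's `TowerPlaces.subsingleton_extension_v_of_discr`, and `[F_n : K̃_n] ≤ 2`); the bound itself is NOT proved here. Nothing here closes the
crux or a registered stub; no summit statement is proved by this seat; BSD is not proved by any of this. THEOREMS ONLY (no definition, no named fact, no
instance, no `sorry`).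

* `pow_factorial_smul_eq_self` — `g^{B!} • x = x` for a group acting on a finite type of cardinality `≤ B` (`orderOf` in `Perm X` divides `(#X)! ∣ B!`).
* `algEquiv_pow_factorial_smul_place_eq_self` — for `σ ∈ Gal(F/K)` and the (finite) set of places of `F` above `p` of cardinality `≤ B`: `σ^{B!}` fixes each.
* `forall_exists_smul_mem_range_of_ncard_le` — FILE 8i's `forall_exists_smul_mem_range` (the `hgcoker` of g8's FILE 4a, verbatim shape) under `hbound`.

References: J. Johnson-Leung, G. Kings (2011) §5.4 Lemma 5.8; J. Neukirch, *Algebraic Number Theory* (1999) Ch. I §9 (finitely many primes above `p`).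
-/

noncomputable section

open scoped Classical

-- the summit namespace `Summit.BirchSwinnertonDyer.BirchSwinnertonDyer` repeats the problem name by design (D-0017)
set_option linter.dupNamespace false
set_option autoImplicit false

open scoped NumberField
open Field IsDedekindDomain IntermediateField
open Literature.NumberTheory.GaloisRepresentations Literature.NumberTheory.GaloisRepresentations.DiscreteGaloisModule
open Literature.NumberTheory.GaloisRepresentations.LocalWeilDatum
open Literature.NumberTheory.EllipticCurves
open Literature.NumberTheory.ComplexMultiplication.EllipticUnits
open Literature.NumberTheory.ComplexMultiplication.EllipticUnits.JohnsonLeungKings2011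
open Summit.BirchSwinnertonDyer.BirchSwinnertonDyer.Theorems.PrintCf2

namespace Summit.BirchSwinnertonDyer.BirchSwinnertonDyer.Theorems.PrintCf2.RowTwo

/-! ## §1. Permutations of a small finite set -/

/-- **`g^{B!} • x = x`** for a group `G` acting on a finite type `X` with `#X ≤ B`: the permutation `g ↦ (g • ·)` has order dividing `#Perm X = (#X)!`,
which divides `B!`. [folklore] -/
theorem pow_factorial_smul_eq_self {G X : Type*} [Group G] [MulAction G X] [Fintype X] (g : G) (x : X) {B : ℕ} (hB : Fintype.card X ≤ B) :
    g ^ B.factorial • x = x := by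
  have h1 : (MulAction.toPermHom G X g) ^ B.factorial = 1 := by
    have h2 : orderOf (MulAction.toPermHom G X g) ∣ B.factorial :=
      (orderOf_dvd_card (G := Equiv.Perm X)).trans (by rw [Fintype.card_perm]; exact Nat.factorial_dvd_factorial hB)
    exact orderOf_dvd_iff_pow_eq_one.mp h2
  rw [← map_pow] at h1
  have h3 := congrArg (fun σ : Equiv.Perm X ↦ σ x) h1
  simpa only [MulAction.toPermHom_apply, MulAction.toPerm_apply, Equiv.Perm.coe_one, id_eq] using h3

/-! ## §2. Places above `p` in a finite Galois layer -/

section Places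

variable {K : Type} [Field K] [NumberField K] (p : ℕ) [Fact p.Prime]

/-- The places of a number field `F ⊇ K` above `p` form a finite set (they divide the non-zero ideal `(p)`). [cite: NeukirchANT1999, Ch. I §9] -/
theorem finite_setOf_natCast_mem_under (F : IntermediateField K (AlgebraicClosure K)) [NumberField F] :
    {w : HeightOneSpectrum (𝓞 F) | ((p : ℕ) : 𝓞 K) ∈ (w.under (𝓞 K)).asIdeal}.Finite := by
  have hp0 : (Ideal.span {((p : ℕ) : 𝓞 F)} : Ideal (𝓞 F)) ≠ 0 := by
    rw [Ne, Ideal.zero_eq_bot, Ideal.span_singleton_eq_bot]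
    exact_mod_cast (Fact.out : p.Prime).ne_zero
  refine (Ideal.finite_factors hp0).subset fun w hw ↦ ?_
  rw [Set.mem_setOf_eq] at hw ⊢
  rw [Ideal.dvd_span_singleton]
  have : (algebraMap (𝓞 K) (𝓞 F)) ((p : ℕ) : 𝓞 K) ∈ w.asIdeal := hw
  rwa [map_natCast] at this

/-- **`σ^{B!}` fixes every place above `p`** when there are at most `B` of them (`σ ∈ Gal(F/K)`; the set of places above `p` is `Gal(F/K)`-stable).
[cite: NeukirchANT1999, Ch. I §9] -/
theorem algEquiv_pow_factorial_smul_place_eq_self (F : IntermediateField K (AlgebraicClosure K)) [NumberField F] (σ : F ≃ₐ[K] F) {B : ℕ}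
    (hB : {w : HeightOneSpectrum (𝓞 F) | ((p : ℕ) : 𝓞 K) ∈ (w.under (𝓞 K)).asIdeal}.ncard ≤ B)
    (w : HeightOneSpectrum (𝓞 F)) (hw : ((p : ℕ) : 𝓞 K) ∈ (w.under (𝓞 K)).asIdeal) : σ ^ B.factorial • w = w := by
  let T : Set (HeightOneSpectrum (𝓞 F)) := {w | ((p : ℕ) : 𝓞 K) ∈ (w.under (𝓞 K)).asIdeal}
  have hTfin : T.Finite := finite_setOf_natCast_mem_under p F
  haveI : Fintype T := hTfin.fintype
  have hstab : ∀ (τ : F ≃ₐ[K] F) (w : HeightOneSpectrum (𝓞 F)), w ∈ T → τ • w ∈ T := by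
    intro τ w hw
    change ((p : ℕ) : 𝓞 K) ∈ ((τ • w).under (𝓞 K)).asIdeal
    rw [Literature.NumberTheory.Automorphic.HeightOneSpectrum.under_algEquiv_smul K F τ w]
    exact hw
  -- the restricted action on the subtype `T`
  letI : MulAction (F ≃ₐ[K] F) T :=
    { smul := fun τ w ↦ ⟨τ • (w : HeightOneSpectrum (𝓞 F)), hstab τ w w.2⟩
      one_smul := fun w ↦ Subtype.ext (one_smul _ (w : HeightOneSpectrum (𝓞 F)))
      mul_smul := fun τ τ' w ↦ Subtype.ext (mul_smul τ τ' (w : HeightOneSpectrum (𝓞 F))) }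
  have hcoe : ∀ (τ : F ≃ₐ[K] F) (w : T), ((τ • w : T) : HeightOneSpectrum (𝓞 F)) = τ • (w : HeightOneSpectrum (𝓞 F)) := fun _ _ ↦ rfl
  have hpow : ∀ (n : ℕ) (w : T), ((σ ^ n • w : T) : HeightOneSpectrum (𝓞 F)) = σ ^ n • (w : HeightOneSpectrum (𝓞 F)) := fun n w ↦ hcoe _ w
  have hcard : Fintype.card T ≤ B := by
    rw [← Nat.card_eq_fintype_card, Nat.card_coe_set_eq]; exact hB
  have key := pow_factorial_smul_eq_self σ (⟨w, hw⟩ : T) hcard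
  have := congrArg (fun z : T ↦ (z : HeightOneSpectrum (𝓞 F))) key
  simpa only [hpow] using this

end Places

/-! ## §3. `hgcoker` under the bound on the number of places above `p` -/

variable {K : Type} [Field K] [NumberField K] [IsGalois K (AlgebraicClosure K)] {p : ℕ} [Fact p.Prime] (ι : K →+* ℂ)
  (K₀ : IntermediateField K (AlgebraicClosure K)) [FiniteDimensional K K₀] [IsAbelianGalois K K₀]
  (κ₁ κ₂ : ZpExtension K p) (θ' : absoluteGaloisGroup K →ₜ* ℤ_[p]ˣ) (𝔣 : Ideal (𝓞 K))
  (θ : FramedGaloisRep K (padicCoeffIntegers (∅ : Set (PadicAlgCl p))) 1) (η₁ η₂ : absoluteGaloisGroup K)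
  (E : UnitIndexData₂ ι K₀ κ₁ κ₂ θ η₁ η₂) (I : IwasawaCohomologyData p κ₁ κ₂ η₁ η₂ θ' 𝔣 1)
  [∀ n, NumberField (rubinLayer K₀ κ₁ κ₂ n)] [∀ n, Normal K (rubinLayer K₀ κ₁ κ₂ n)]

/-- **`hgcoker` of g8's FILE 4a (verbatim shape) under a UNIFORM BOUND `B` on the number of places above `p` in the layers `F_n`** (replacing FILE 8i's
`hfix₁/hfix₂` by `M = B!`; all other displayed hypotheses as in FILE 8i). [cite: JohnsonLeungKings2011, §5.4 Lemma 5.8 (arXiv p0015:L130–161)] [cite: NeukirchSchmidtWingberg2008, Ch. V §1 (5.1.4)] -/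
theorem forall_exists_smul_mem_range_of_ncard_le
    (hNK₀ : ramificationSubgroup K (suppPF p 𝔣) ≤ galFixing K K₀) (hθ'K₀ : ∀ σ ∈ galFixing K K₀, θ' σ = 1)
    (hθθ' : ∀ σ ∈ ZpExtension.pairKer κ₁ κ₂, algebraMap ℚ_[p] (PadicAlgCl p) ((((θ' σ)⁻¹ : ℤ_[p]ˣ) : ℤ_[p]) : ℚ_[p]) =
      (((θ σ : GL (Fin 1) (padicCoeffIntegers (∅ : Set (PadicAlgCl p)))).val 0 0 :
        padicCoeffIntegers (∅ : Set (PadicAlgCl p))) : PadicAlgCl p))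
    (hΔ : ∀ n, ∀ δ ∈ JohnsonLeungKings2011.pairLayerSubgroup κ₁ κ₂ n, ∃ π ∈ ZpExtension.pairKer κ₁ κ₂,
      ∃ υ ∈ galFixing K (rubinLayer K₀ κ₁ κ₂ n), δ = π * υ)
    (hidx : ∀ n, ((ellipticUnits ι (rubinLayer K₀ κ₁ κ₂ n)).subgroupOf (globalUnitsOf (rubinLayer K₀ κ₁ κ₂ n))).index ≠ 0)
    (Ct : Submodule (IwasawaAlgebra₂ p) I.H) (G : E.Q → I.H) (g : E.Q →ₗ[IwasawaAlgebra₂ p] I.H ⧸ Ct)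
    (hCt : ∀ h : I.H, h ∈ Ct ↔ ∀ n k : ℕ, I.proj n k h ∈
        AddSubgroup.closure {x : layerCoh p κ₁ κ₂ θ' 𝔣 n k 1 | ∃ (m : ℕ) (hmn : n ≤ m) (e β : (AlgebraicClosure K)ˣ)
          (c : levelCoh p (suppPF p 𝔣) θ' (galFixing K (rubinLayer K₀ κ₁ κ₂ m)) k 1),
          e ∈ ellipticUnits ι (rubinLayer K₀ κ₁ κ₂ m) ∧ e ∈ globalUnitsOf (rubinLayer K₀ κ₁ κ₂ m) ∧ β ^ (p ^ k) = e ∧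
          IsTwistedKummerClass p θ' (suppPF p 𝔣) (galFixing K (rubinLayer K₀ κ₁ κ₂ m)) k β c ∧
          x = relCores p (suppPF p 𝔣) θ' (galFixing_rubinLayer_le_pairLayerSubgroup p K₀ κ₁ κ₂ hmn)
            (JohnsonLeungKings2011.isOpen_pairLayerSubgroup κ₁ κ₂ n) (isOpen_galFixing_rubinLayer p K₀ κ₁ κ₂ m) k 1 c})
    (hG : ∀ (q : E.Q) (n k : ℕ) (u β : (AlgebraicClosure K)ˣ) (c : levelCoh p (suppPF p 𝔣) θ' (galFixing K (rubinLayer K₀ κ₁ κ₂ n)) k 1),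
      u ∈ globalUnitsOf (rubinLayer K₀ κ₁ κ₂ n) → E.proj n q = unitIndexClass ι K₀ κ₁ κ₂ n u → β ^ (p ^ k) = u →
      IsTwistedKummerClass p θ' (suppPF p 𝔣) (galFixing K (rubinLayer K₀ κ₁ κ₂ n)) k β c →
      I.proj n k (G q) - relCores p (suppPF p 𝔣) θ' (galFixing_rubinLayer_le_pairLayerSubgroup p K₀ κ₁ κ₂ le_rfl)
          (JohnsonLeungKings2011.isOpen_pairLayerSubgroup κ₁ κ₂ n) (isOpen_galFixing_rubinLayer p K₀ κ₁ κ₂ n) k 1 c ∈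
        AddSubgroup.closure {x : layerCoh p κ₁ κ₂ θ' 𝔣 n k 1 | ∃ (m : ℕ) (hmn : n ≤ m) (e β : (AlgebraicClosure K)ˣ)
          (c : levelCoh p (suppPF p 𝔣) θ' (galFixing K (rubinLayer K₀ κ₁ κ₂ m)) k 1),
          e ∈ ellipticUnits ι (rubinLayer K₀ κ₁ κ₂ m) ∧ e ∈ globalUnitsOf (rubinLayer K₀ κ₁ κ₂ m) ∧ β ^ (p ^ k) = e ∧
          IsTwistedKummerClass p θ' (suppPF p 𝔣) (galFixing K (rubinLayer K₀ κ₁ κ₂ m)) k β c ∧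
          x = relCores p (suppPF p 𝔣) θ' (galFixing_rubinLayer_le_pairLayerSubgroup p K₀ κ₁ κ₂ hmn)
            (JohnsonLeungKings2011.isOpen_pairLayerSubgroup κ₁ κ₂ n) (isOpen_galFixing_rubinLayer p K₀ κ₁ κ₂ m) k 1 c})
    (hg : ∀ q : E.Q, g q = Ct.mkQ (G q))
    (hθ'η₁ : θ' η₁ = 1) (hθ'η₂ : θ' η₂ = 1)
    (hram : ∀ (n : ℕ) (w : HeightOneSpectrum (𝓞 (rubinLayer K₀ κ₁ κ₂ n))), w.under (𝓞 K) ∈ suppPF p 𝔣 →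
      ((p : ℕ) : 𝓞 K) ∉ (w.under (𝓞 K)).asIdeal → ∃ δ ∈ JohnsonLeungKings2011.pairLayerSubgroup κ₁ κ₂ n, θ' δ = -1 ∧
        resGal (rubinLayer K₀ κ₁ κ₂ n) δ • w = w)
    {B : ℕ} (hbound : ∀ n, {w : HeightOneSpectrum (𝓞 (rubinLayer K₀ κ₁ κ₂ n)) | ((p : ℕ) : 𝓞 K) ∈ (w.under (𝓞 K)).asIdeal}.ncard ≤ B) :
    ∀ 𝔭 : PrimeSpectrum (IwasawaAlgebra₂ p), 𝔭.asIdeal.height ≤ 1 → ((p : ℕ) : IwasawaAlgebra₂ p) ∉ 𝔭.asIdeal →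
      ∀ y : I.H ⧸ Ct, ∃ r ∉ 𝔭.asIdeal, r • y ∈ LinearMap.range g :=
  forall_exists_smul_mem_range ι K₀ κ₁ κ₂ θ' 𝔣 θ η₁ η₂ E I hNK₀ hθ'K₀ hθθ' hΔ hidx Ct G g hCt hG hg hθ'η₁ hθ'η₂ hram (Nat.factorial_ne_zero B)
    (fun n w hw ↦ by rw [map_pow]; exact algEquiv_pow_factorial_smul_place_eq_self p (rubinLayer K₀ κ₁ κ₂ n) _ (hbound n) w hw)
    (fun n w hw ↦ by rw [map_pow]; exact algEquiv_pow_factorial_smul_place_eq_self p (rubinLayer K₀ κ₁ κ₂ n) _ (hbound n) w hw)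

end Summit.BirchSwinnertonDyer.BirchSwinnertonDyer.Theorems.PrintCf2.RowTwo

end
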